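import Literature.AlgebraicGeometry.Motives.HodgeThetaSubalgebraUnitary
import Literature.AlgebraicGeometry.Motives.HodgeLieTimesCMSummandRigid
import Literature.AlgebraicGeometry.Motives.HodgeThetaAnnihilatorTimesNonCMCurve
import HarnessLib

/-!
# Two unitary summands `H ≅ H₁ ⊕ H₂`: complex block calculus on `𝔥(H) ⊗ ℂ` and the line `W ∩ H^{0,1}` of a summand of Ribet type `(m, 1)`
# (plumbing for the unitary analogue of Moonen–Zarhin's Lemma (3.4): `CorCM/MumfordTateRankUnitaryPairIntertwiner`)

COR-CM (cell `pub-hodgecm2`, seat `b27` gen 52, count-neutral Mumford–Tate-rank ladder; theorems only, no definition, no named fact;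
UNCONDITIONAL — nothing here uses or asserts HC_CM).  Abstract Hodge-structure level (`Literature.AlgebraicGeometry.Motives.HodgeStructure`),
written under `CorCM/` next to its only consumers (the exact `{3,3}` cell of two simple type-IV(2,1) threefolds).

SETTING.  `H ≅ H₁ ⊕ H₂` a `ℚ`-Hodge structure decomposed by morphisms `ι_i`, `π_i` (`π_iι_i = 1`, `ι₁π₁ + ι₂π₂ = 1`); `𝔥 = 𝔥(H)` the Hodge Lie
algebra (annihilator of the Hodge tensors), `𝔥 ⊗ ℂ = spanC 𝔥` its complex span inside `End_ℂ(H_ℂ)`.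
* §1 `eq_sum_blocks_of_mem_spanC` — every `Z ∈ 𝔥 ⊗ ℂ` is block diagonal, `Z = ι₁(π₁Zι₁)π₁ + ι₂(π₂Zι₂)π₂`;
  `restrict₁_mul_spanC`, `restrict₂_mul_spanC` — the complex restrictions `Z ↦ π_i Z ι_i` are multiplicative on `𝔥 ⊗ ℂ`;
  `restrict_mem_spanC` — they take values in `𝔥(H_i) ⊗ ℂ`.  (Complex spans of the rational statements `eq_sum_blocks_of_mem_hodgeLie`,
  `restrict_mul`, `comp_mem_hodgeLie_of_retract` of `Motives/HodgeLie{SemisimpleTimesAbelian,ProductSimpleFactor,DirectSum}`.)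
* §2 `exists_line_data` — for a weight-one `H₁` with an imaginary quadratic Hodge endomorphism `φ₁` whose `μ₁`-eigenspace `W₁ = ker(φ_{1,ℂ} − μ₁)`
  meets `H₁^{0,1}` in a LINE (Ribet type `(m, 1)`, Moonen–Zarhin (2.3) type IV(1,1)): a generator `ℓ` of the line and a coordinate `f ∈ W₁^*`
  with `f(u)·ℓ = (u − Θ₁u)/2` and `f(ℓ) = 1`, i.e. `Θ₁|_{W₁} = 1 − 2·ℓ ⊗ f` — the grading datum of `Algebra/Lie/LineGradedIntertwiner`.

## References
* [MoonenZarhin1999LowDim] B. Moonen, Yu. G. Zarhin, *Hodge classes on abelian varieties of low dimension*, Math. Ann. 315 (1999), §2 (2.3),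
  §3 (3.1) [corpus: paper:arxiv-math_9901113 pp. 5–6]. [cite: MoonenZarhin1999LowDim, §3 (3.1)]
* [Deligne1982HodgeCycles] P. Deligne, *Hodge cycles on abelian varieties*, LNM 900 (1982), I §3 (proof of Prop. 3.4), §4 (p. 30).
  [cite: Deligne1982HodgeCycles, I §3 (proof of Prop. 3.4)]
-/

noncomputable section

open scoped TensorProduct

namespace Summit.HodgeConjecture.CorCM

namespace UnitaryPair

open Literature.AlgebraicGeometry.Motives Literature.AlgebraicGeometry.Motives.HodgeStructure Module

universe u

variable {V₁ : Type u} [AddCommGroup V₁] [Module ℚ V₁] [Module.Finite ℚ V₁]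
  {V₂ : Type u} [AddCommGroup V₂] [Module ℚ V₂] [Module.Finite ℚ V₂]
  {V : Type u} [AddCommGroup V] [Module ℚ V] [Module.Finite ℚ V] [HodgeTensorFacts.{u, u}] {n : ℤ}
  {H₁ : HodgeStructure V₁ n} {H₂ : HodgeStructure V₂ n} {H : HodgeStructure V n}
  (ι₁ : Hom H₁ H) (π₁ : Hom H H₁) (ι₂ : Hom H₂ H) (π₂ : Hom H H₂)
  (hπι₁ : ∀ v, π₁.toLinearMap (ι₁.toLinearMap v) = v) (hπι₂ : ∀ v, π₂.toLinearMap (ι₂.toLinearMap v) = v)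
  (hsum : ∀ v, ι₁.toLinearMap (π₁.toLinearMap v) + ι₂.toLinearMap (π₂.toLinearMap v) = v)

/-! ## §1 Complex block calculus on `𝔥(H) ⊗ ℂ` -/

omit [Module.Finite ℚ V₁] [Module.Finite ℚ V₂] [Module.Finite ℚ V] [HodgeTensorFacts.{u, u}] in
include hπι₁ hπι₂ hsum in
/-- `π₂ ι₁ = 0`. [folklore] -/
theorem proj₂_comp_incl₁ : π₂.toLinearMap ∘ₗ ι₁.toLinearMap = 0 := by
  refine LinearMap.ext fun v => ?_
  have h := congrArg π₂.toLinearMap (hsum (ι₁.toLinearMap v))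
  rw [map_add, hπι₁ v, hπι₂] at h
  rw [LinearMap.comp_apply, LinearMap.zero_apply]
  exact add_eq_left.1 h

omit [Module.Finite ℚ V₁] [Module.Finite ℚ V₂] [Module.Finite ℚ V] [HodgeTensorFacts.{u, u}] in
include hπι₁ hπι₂ hsum in
/-- `π₁ ι₂ = 0`. [folklore] -/
theorem proj₁_comp_incl₂ : π₁.toLinearMap ∘ₗ ι₂.toLinearMap = 0 := by
  refine LinearMap.ext fun v => ?_
  have h := congrArg π₁.toLinearMap (hsum (ι₂.toLinearMap v))
  rw [map_add, hπι₂ v, hπι₁] at h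
  rw [LinearMap.comp_apply, LinearMap.zero_apply]
  exact add_eq_right.1 h

omit [Module.Finite ℚ V₁] [Module.Finite ℚ V₂] in
include hπι₁ hπι₂ hsum in
/-- **Block form on `𝔥(H) ⊗ ℂ`**: `Z = ι₁(π₁Zι₁)π₁ + ι₂(π₂Zι₂)π₂` for `Z ∈ 𝔥(H)_ℂ` (complex span of the rational block form
`eq_sum_blocks_of_mem_hodgeLie`). [cite: MoonenZarhin1999LowDim, §3 (3.1)] -/
theorem eq_sum_blocks_of_mem_spanC {Z : Module.End ℂ (ℂ ⊗[ℚ] V)} (hZ : Z ∈ spanC H.hodgeLie) :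
    Z = ι₁.toLinearMap.baseChange ℂ ∘ₗ (π₁.toLinearMap.baseChange ℂ ∘ₗ Z ∘ₗ ι₁.toLinearMap.baseChange ℂ) ∘ₗ π₁.toLinearMap.baseChange ℂ +
      ι₂.toLinearMap.baseChange ℂ ∘ₗ (π₂.toLinearMap.baseChange ℂ ∘ₗ Z ∘ₗ ι₂.toLinearMap.baseChange ℂ) ∘ₗ π₂.toLinearMap.baseChange ℂ := by
  induction hZ using Submodule.span_induction with
  | mem Z hZ =>
    obtain ⟨X, hX, rfl⟩ := hZ
    have h := eq_sum_blocks_of_mem_hodgeLie ι₁ π₁ ι₂ π₂ hπι₁ hπι₂ hsum hX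
    apply_fun (fun T : Module.End ℚ V => T.baseChange ℂ) at h
    simpa only [LinearMap.baseChange_add, LinearMap.baseChange_comp] using h
  | zero => simp
  | add Z Z' _ _ hZ hZ' =>
    conv_lhs => rw [hZ, hZ']
    simp only [LinearMap.comp_add, LinearMap.add_comp]
    abel
  | smul c Z _ hZ =>
    conv_lhs => rw [hZ]
    simp only [LinearMap.comp_smul, LinearMap.smul_comp, smul_add]

omit [Module.Finite ℚ V₁] [Module.Finite ℚ V₂] in
include hπι₁ hπι₂ hsum in
/-- **The complex restriction `Z ↦ π₁ Z ι₁` is multiplicative on `𝔥(H) ⊗ ℂ`** (block form of the second factor, `π₁ι₁ = 1`, `π₁ι₂ = 0`).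
[cite: MoonenZarhin1999LowDim, §3 (3.1)] -/
theorem restrict₁_mul_spanC {Z Z' : Module.End ℂ (ℂ ⊗[ℚ] V)} (hZ' : Z' ∈ spanC H.hodgeLie) :
    π₁.toLinearMap.baseChange ℂ ∘ₗ (Z * Z') ∘ₗ ι₁.toLinearMap.baseChange ℂ =
      (π₁.toLinearMap.baseChange ℂ ∘ₗ Z ∘ₗ ι₁.toLinearMap.baseChange ℂ) * (π₁.toLinearMap.baseChange ℂ ∘ₗ Z' ∘ₗ ι₁.toLinearMap.baseChange ℂ) := by
  have hπι₁' : π₁.toLinearMap ∘ₗ ι₁.toLinearMap = LinearMap.id := LinearMap.ext hπι₁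
  have h21 : ∀ x, π₂.toLinearMap.baseChange ℂ (ι₁.toLinearMap.baseChange ℂ x) = 0 := fun x =>
    proj_incl_baseChange_eq_zero (proj₂_comp_incl₁ ι₁ π₁ ι₂ π₂ hπι₁ hπι₂ hsum) x
  refine LinearMap.ext fun x => ?_
  have h1 : Z' (ι₁.toLinearMap.baseChange ℂ x) =
      ι₁.toLinearMap.baseChange ℂ (π₁.toLinearMap.baseChange ℂ (Z' (ι₁.toLinearMap.baseChange ℂ x))) := by
    have h := congrArg (fun f => f (ι₁.toLinearMap.baseChange ℂ x)) (eq_sum_blocks_of_mem_spanC ι₁ π₁ ι₂ π₂ hπι₁ hπι₂ hsum hZ')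
    simp only [LinearMap.add_apply, LinearMap.comp_apply, proj_incl_baseChange hπι₁', h21, map_zero, add_zero] at h
    exact h
  simp only [Module.End.mul_apply, LinearMap.comp_apply]
  conv_lhs => rw [h1]

omit [Module.Finite ℚ V₁] [Module.Finite ℚ V₂] in
include hπι₁ hπι₂ hsum in
/-- The complex restriction `Z ↦ π₂ Z ι₂` is multiplicative on `𝔥(H) ⊗ ℂ`. [cite: MoonenZarhin1999LowDim, §3 (3.1)] -/
theorem restrict₂_mul_spanC {Z Z' : Module.End ℂ (ℂ ⊗[ℚ] V)} (hZ' : Z' ∈ spanC H.hodgeLie) :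
    π₂.toLinearMap.baseChange ℂ ∘ₗ (Z * Z') ∘ₗ ι₂.toLinearMap.baseChange ℂ =
      (π₂.toLinearMap.baseChange ℂ ∘ₗ Z ∘ₗ ι₂.toLinearMap.baseChange ℂ) * (π₂.toLinearMap.baseChange ℂ ∘ₗ Z' ∘ₗ ι₂.toLinearMap.baseChange ℂ) :=
  restrict₁_mul_spanC ι₂ π₂ ι₁ π₁ hπι₂ hπι₁ (fun v => by rw [add_comm]; exact hsum v) hZ'

omit [Module.Finite ℚ V₂] [Module.Finite ℚ V] [HodgeTensorFacts.{u, u}] in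
include hπι₁ in
/-- `π₁ Z ι₁ ∈ 𝔥(H₁) ⊗ ℂ` for `Z ∈ 𝔥(H) ⊗ ℂ` (`comp_mem_hodgeLie_of_retract`, complex span). [cite: MoonenZarhin1999LowDim, §3 (3.1)] -/
theorem restrict_mem_spanC [Module.Finite ℚ V] [HodgeTensorFacts.{u, u}] {Z : Module.End ℂ (ℂ ⊗[ℚ] V)} (hZ : Z ∈ spanC H.hodgeLie) :
    π₁.toLinearMap.baseChange ℂ ∘ₗ Z ∘ₗ ι₁.toLinearMap.baseChange ℂ ∈ spanC H₁.hodgeLie := by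
  have h := map_mem_spanC_map ((LinearMap.llcomp ℚ V₁ V V₁ π₁.toLinearMap).comp (LinearMap.lcomp ℚ V ι₁.toLinearMap))
    ((LinearMap.llcomp ℂ _ _ _ (π₁.toLinearMap.baseChange ℂ)).comp (LinearMap.lcomp ℂ _ (ι₁.toLinearMap.baseChange ℂ)))
    (fun X => by
      change π₁.toLinearMap.baseChange ℂ ∘ₗ X.baseChange ℂ ∘ₗ ι₁.toLinearMap.baseChange ℂ = (π₁.toLinearMap ∘ₗ X ∘ₗ ι₁.toLinearMap).baseChange ℂ
      rw [← LinearMap.baseChange_comp, ← LinearMap.baseChange_comp]) H.hodgeLie hZ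
  refine spanC_mono ?_ h
  rintro _ ⟨X, hX, rfl⟩
  exact comp_mem_hodgeLie_of_retract ι₁ π₁ hπι₁ hX

omit [Module.Finite ℚ V₁] in
/-- **The line `W ∩ H^{0,1}` and its coordinate.**  For a weight-one Hodge structure with an imaginary quadratic Hodge endomorphism `φ` whose
`μ`-eigenspace `W` meets `H^{0,1}` in a LINE: a generator `ℓ` of that line and a linear functional `f` on `W` with `f(u)·ℓ = (u − Θu)/2` (the
`H^{0,1}`-component), `f(ℓ) = 1` — so `Θ|_W = 1 − 2·ℓ ⊗ f`. [cite: MoonenZarhin1999LowDim, §2 (2.3)] [cite: Deligne1982HodgeCycles, §4 (p. 30)] -/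
theorem exists_line_data [Module.Finite ℚ V₁] (hn : n = 1) (heff₁ : H₁.IsEffective) {φ₁ : Module.End ℚ V₁} (hφ₁E : φ₁ ∈ H₁.endAlg) {μ₁ : ℂ}
    (h1₁ : Module.finrank ℂ ↥(Module.End.eigenspace (φ₁.baseChange ℂ) μ₁ ⊓ H₁.piece 0 1) = 1)
    {Θ₁ : Module.End ℂ (ℂ ⊗[ℚ] V₁)} (hΘ₁ : ∀ p, ∀ x ∈ H₁.piece p (n - p), Θ₁ x = ((2 * p - n : ℤ) : ℂ) • x) :
    ∃ (ℓ : ↥(Module.End.eigenspace (φ₁.baseChange ℂ) μ₁)) (f : Module.Dual ℂ ↥(Module.End.eigenspace (φ₁.baseChange ℂ) μ₁)),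
      f ℓ = 1 ∧ (ℓ : ℂ ⊗[ℚ] V₁) ∈ H₁.piece 0 1 ∧ (ℓ : ℂ ⊗[ℚ] V₁) ≠ 0 ∧
      (∀ u : ↥(Module.End.eigenspace (φ₁.baseChange ℂ) μ₁), f u • (ℓ : ℂ ⊗[ℚ] V₁) = (2 : ℂ)⁻¹ • ((u : ℂ ⊗[ℚ] V₁) - Θ₁ u)) ∧
      ∀ s ∈ Module.End.eigenspace (φ₁.baseChange ℂ) μ₁ ⊓ H₁.piece 0 1, ∃ c : ℂ, s = c • (ℓ : ℂ ⊗[ℚ] V₁) := by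
  classical
  obtain ⟨hP, hQ, hΘ10, hΘ01, -⟩ := UnitaryTheta.theta_facts H₁ hn heff₁ hΘ₁
  subst hn
  set W := Module.End.eigenspace (φ₁.baseChange ℂ) μ₁ with hWdef
  set L := W ⊓ H₁.piece 0 1 with hLdef
  have hΘφ : Θ₁ * φ₁.baseChange ℂ = φ₁.baseChange ℂ * Θ₁ :=
    commute_baseChange_of_mem_hodgeLieC H₁ (H₁.mem_hodgeLieC_of_forall_piece hΘ₁) ⟨φ₁, hφ₁E⟩
  have hΘW : ∀ w ∈ W, Θ₁ w ∈ W := fun w hw => UnitaryTheta.apply_mem_eigenspace_of_commute hΘφ hw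
  let b := Module.finBasisOfFinrankEq ℂ L h1₁
  have hQmem : ∀ u : W, (2 : ℂ)⁻¹ • ((u : ℂ ⊗[ℚ] V₁) - Θ₁ u) ∈ L := fun u =>
    Submodule.mem_inf.2 ⟨Submodule.smul_mem _ _ (Submodule.sub_mem _ u.2 (hΘW _ u.2)), hQ u⟩
  let Q : W →ₗ[ℂ] L := LinearMap.codRestrict L (((2 : ℂ)⁻¹ • (W.subtype - Θ₁ ∘ₗ W.subtype))) (fun u => by
    simpa only [LinearMap.smul_apply, LinearMap.sub_apply, LinearMap.comp_apply, Submodule.subtype_apply] using hQmem u)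
  have hQ' : ∀ u : W, ((Q u : L) : ℂ ⊗[ℚ] V₁) = (2 : ℂ)⁻¹ • ((u : ℂ ⊗[ℚ] V₁) - Θ₁ u) := fun u => rfl
  refine ⟨⟨(b 0 : ℂ ⊗[ℚ] V₁), (b 0).2.1⟩, (b.coord 0) ∘ₗ Q, ?_, (b 0).2.2, fun h => b.ne_zero 0 (Subtype.ext h), fun u => ?_,
    fun s hs => ⟨b.repr ⟨s, hs⟩ 0, ?_⟩⟩
  · -- `f ℓ = 1`: `Q ℓ = ℓ`
    have hQℓ : Q ⟨(b 0 : ℂ ⊗[ℚ] V₁), (b 0).2.1⟩ = b 0 := Subtype.ext (by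
      rw [hQ', hΘ01 _ (b 0).2.2]
      module)
    rw [LinearMap.comp_apply, hQℓ, Basis.coord_apply, Basis.repr_self, Finsupp.single_eq_same]
  · -- `f u • ℓ = Q u`
    have h := b.sum_repr (Q u)
    rw [Fin.sum_univ_one] at h
    have h' := congrArg Subtype.val h
    rw [Submodule.coe_smul, hQ'] at h'
    rw [LinearMap.comp_apply, Basis.coord_apply]
    exact h'
  · have h := b.sum_repr ⟨s, hs⟩
    rw [Fin.sum_univ_one] at h
    exact (congrArg Subtype.val h).symm

end UnitaryPair

end Summit.HodgeConjecture.CorCM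

end
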